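import Mathlib
import Summits.NavierStokesRegularity.NavierStokesRegularity.Theorems.WakeRatchetTailRatchet.Negative.TailRatchetFalseOfDyadicScalarFronts
import HarnessLib

/-!
# Scalar dyadic fronts (the construction `DyadicScalarFronts` of stmt-NavierStokesRegularity-21808):
# a-priori structure at the blow-up time — the wake limit `a(0⁻)` exists, and the FROZEN-WAKE criterion `s³ = Λ²`

The construction item `WakeRatchetDyadicFront.DyadicScalarFronts` (p589335; the hypothesis modulo which the crux
`WakeRatchet.TailRatchet` and — by `WakeRatchetBirthStubs` — its registered stubs are refuted) asks for a real
function `a` on `t < 0` solving the front equation of the inviscid dyadic chain at base `Λ = bigLam ε₀`,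
  `a'(t) = (Λ/s²)·a(t/s)² − (s/Λ)·a(t)·a(st)`,
integrable on `(−∞,0)` and bounded near `0⁻` (then `a_n(t) = (s/Λ)ⁿ a(sⁿt)` is an exact DSS blow-up front with
per-shell energy ratio `μ = s²/Λ²`).  This file proves two elementary a-priori facts about ANY such profile
(existence is not assumed globally — only the clauses of the item near `0⁻`):

* `exists_wake_limit`: the WAKE `a(0⁻) = lim_{t→0⁻} a(t)` exists (the derivative is bounded near `0⁻`, so
  `a + Kt` is monotone and bounded there);
* `deriv_tendsto`: `a'(t) → a(0⁻)²·(Λ/s² − s/Λ)` as `t → 0⁻`; hence (`frozen_wake_iff`) for a non-zero wake the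
  profile is STATIONARY at the blow-up time iff `s³ = Λ²`, i.e. iff the per-shell energy ratio is EXACTLY the
  Kolmogorov value `μ = s²/Λ² = Λ^{−2/3} = (1+ε₀)^{−5/3}` (`dssMu_eq_of_frozen`).

Context (item evidence `ASYMPTOTICS-21808-leafhand-g0.md`): the kit fronts of the dyadic member have
`μ/Λ^{−2/3} → 1` as `ε₀ → 0` (1 − μ ≈ 1.66 ε₀); the matched asymptotics derive `μ = Λ^{−2/3+o(1)}`; this file
records the exact dichotomy behind the observed near-identity: either the wake is still moving at `t = 0`
(`a'(0⁻) ≠ 0`) or the rate is exactly Kolmogorov.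

HONEST FRAMING: elementary real analysis about a MODEL lattice ODE (Tao 2016 §1.2, §4); nothing here concerns
the Navier–Stokes equations; no item is closed; the existence of such fronts stays open.
-/

noncomputable section

set_option linter.dupNamespace false

namespace Summit.NavierStokesRegularity.NavierStokesRegularity.Theorems

namespace WakeRatchetScalarFront

open Filter Topology Set
open Literature.Analysis.FluidPDE Literature.Analysis.FluidPDE.TaoCascade

variable {ε₀ s : ℝ} {a : ℝ → ℝ}

/-- **The wake limit exists.**  A solution of the scalar front equation on `t < 0` that is bounded near `0⁻`
has a limit `a(0⁻)`: on `[t₀/s, 0)` both retarded and advanced arguments stay in the bounded zone, so `|a'| ≤ K`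
there, `t ↦ a(t) + Kt` is monotone and bounded above, hence convergent.
[cite: Tao2016AveragedNS, §1.2 (dyadic model); elementary] -/
theorem exists_wake_limit (hε : 0 < ε₀) (hs : 1 < s)
    (hode : ∀ t : ℝ, t < 0 → HasDerivAt a
      (bigLam ε₀ / s ^ 2 * a (t / s) ^ 2 - s / bigLam ε₀ * a t * a (s * t)) t)
    (hbdd : ∃ t₀ : ℝ, t₀ < 0 ∧ ∃ P : ℝ, ∀ t : ℝ, t₀ ≤ t → t < 0 → |a t| ≤ P) :
    ∃ L : ℝ, Tendsto a (𝓝[<] 0) (𝓝 L) := by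
  obtain ⟨t₀, ht₀, P, hP⟩ := hbdd
  have hΛ : 0 < bigLam ε₀ := bigLam_pos (by linarith)
  have hs0 : 0 < s := by linarith
  have hP0 : 0 ≤ P := (abs_nonneg _).trans (hP t₀ le_rfl ht₀)
  set t₁ : ℝ := t₀ / s with ht₁
  have ht₁0 : t₁ < 0 := div_neg_of_neg_of_pos ht₀ hs0
  have ht₀₁ : t₀ < t₁ := by
    rw [ht₁, lt_div_iff₀ hs0]; nlinarith
  set K : ℝ := bigLam ε₀ / s ^ 2 * P ^ 2 + s / bigLam ε₀ * P ^ 2 with hK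
  have hK0 : 0 ≤ K := by positivity
  -- derivative bound on `(t₁, 0)`
  have hder : ∀ t ∈ Ioo t₁ 0,
      |bigLam ε₀ / s ^ 2 * a (t / s) ^ 2 - s / bigLam ε₀ * a t * a (s * t)| ≤ K := by
    intro t ht
    have h1 : |a (t / s)| ≤ P := by
      refine hP _ ?_ (div_neg_of_neg_of_pos ht.2 hs0)
      rw [le_div_iff₀ hs0]
      nlinarith [ht.1, ht₀₁, mul_pos (neg_pos.2 ht₀) (sub_pos.2 hs)]
    have h2 : |a t| ≤ P := hP t (by linarith [ht.1]) ht.2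
    have h3 : |a (s * t)| ≤ P := by
      refine hP _ ?_ (by nlinarith [ht.2])
      have := ht.1
      rw [ht₁, div_lt_iff₀ hs0] at this
      linarith
    have hsq : a (t / s) ^ 2 ≤ P ^ 2 := by
      rw [← sq_abs]; exact pow_le_pow_left₀ (abs_nonneg _) h1 2
    have hprod : |a t * a (s * t)| ≤ P * P := by
      rw [abs_mul]; exact mul_le_mul h2 h3 (abs_nonneg _) hP0
    calc |bigLam ε₀ / s ^ 2 * a (t / s) ^ 2 - s / bigLam ε₀ * a t * a (s * t)|
        ≤ |bigLam ε₀ / s ^ 2 * a (t / s) ^ 2| + |s / bigLam ε₀ * a t * a (s * t)| := abs_sub _ _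
      _ = bigLam ε₀ / s ^ 2 * a (t / s) ^ 2 + s / bigLam ε₀ * |a t * a (s * t)| := by
          rw [abs_of_nonneg (by positivity), mul_assoc, abs_mul, abs_of_nonneg (by positivity : 0 ≤ s / bigLam ε₀)]
      _ ≤ bigLam ε₀ / s ^ 2 * P ^ 2 + s / bigLam ε₀ * (P * P) := by
          gcongr
      _ = K := by rw [hK]; ring
  -- `g = a + K t` is monotone and bounded above on `(t₁, 0)`
  set g : ℝ → ℝ := fun t => a t + K * t with hg
  have hgd : ∀ t ∈ Ioo t₁ 0, HasDerivAt g
      (bigLam ε₀ / s ^ 2 * a (t / s) ^ 2 - s / bigLam ε₀ * a t * a (s * t) + K) t := by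
    intro t ht
    have h := (hode t ht.2).add ((hasDerivAt_id' t).const_mul K)
    convert h using 1 <;> first | rfl | ring
  have hmono : MonotoneOn g (Ioo t₁ 0) := by
    refine monotoneOn_of_deriv_nonneg (convex_Ioo t₁ 0) ?_ ?_ ?_
    · exact fun t ht => (hgd t ht).continuousAt.continuousWithinAt
    · rw [interior_Ioo]; exact fun t ht => (hgd t ht).differentiableAt.differentiableWithinAt
    · rw [interior_Ioo]; intro t ht
      rw [(hgd t ht).deriv]
      have := hder t ht
      linarith [neg_abs_le (bigLam ε₀ / s ^ 2 * a (t / s) ^ 2 - s / bigLam ε₀ * a t * a (s * t))]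
  have hbddA : BddAbove (g '' Ioo t₁ 0) := by
    refine ⟨P, ?_⟩
    rintro _ ⟨t, ht, rfl⟩
    have h2 : a t ≤ P := (le_abs_self _).trans (hP t (by linarith [ht.1]) ht.2)
    have : K * t ≤ 0 := mul_nonpos_of_nonneg_of_nonpos hK0 ht.2.le
    simp only [hg]; linarith
  have hglim := MonotoneOn.tendsto_nhdsWithin_Ioo_left (nonempty_Ioo.2 ht₁0) hmono hbddA
  refine ⟨sSup (g '' Ioo t₁ 0) - K * 0, ?_⟩
  have hKt : Tendsto (fun t : ℝ => K * t) (𝓝[<] (0 : ℝ)) (𝓝 (K * 0)) :=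
    ((continuous_const.mul continuous_id).tendsto 0).mono_left nhdsWithin_le_nhds
  have := hglim.sub hKt
  refine this.congr fun t => ?_
  simp [hg]

/-- The retarded / advanced arguments `t/s`, `st` tend to `0⁻` with `t → 0⁻`. [elementary] -/
theorem tendsto_div_nhdsLT (hs : 0 < s) : Tendsto (fun t : ℝ => t / s) (𝓝[<] 0) (𝓝[<] 0) := by
  refine tendsto_nhdsWithin_of_tendsto_nhds_of_eventually_within _ ?_ ?_
  · have : Tendsto (fun t : ℝ => t / s) (𝓝 0) (𝓝 (0 / s)) := (continuous_id.div_const s).tendsto 0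
    rw [zero_div] at this
    exact this.mono_left nhdsWithin_le_nhds
  · filter_upwards [self_mem_nhdsWithin] with t ht using div_neg_of_neg_of_pos ht hs

/-- [elementary] -/
theorem tendsto_mul_nhdsLT (hs : 0 < s) : Tendsto (fun t : ℝ => s * t) (𝓝[<] 0) (𝓝[<] 0) := by
  refine tendsto_nhdsWithin_of_tendsto_nhds_of_eventually_within _ ?_ ?_
  · have : Tendsto (fun t : ℝ => s * t) (𝓝 0) (𝓝 (s * 0)) := (continuous_const.mul continuous_id).tendsto 0
    rw [mul_zero] at this
    exact this.mono_left nhdsWithin_le_nhds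
  · filter_upwards [self_mem_nhdsWithin] with t ht using mul_neg_of_pos_of_neg hs ht

/-- **The velocity of the wake at the blow-up time.**  If `a(t) → L` as `t → 0⁻`, the right-hand side of the
front equation tends to `L²·(Λ/s² − s/Λ)`; so `a` extends `C¹` to `t = 0` with `a'(0⁻) = L²(Λ/s² − s/Λ)`.
[cite: Tao2016AveragedNS, §1.2; elementary] -/
theorem deriv_tendsto (hs : 1 < s) {L : ℝ} (hL : Tendsto a (𝓝[<] 0) (𝓝 L)) :
    Tendsto (fun t => bigLam ε₀ / s ^ 2 * a (t / s) ^ 2 - s / bigLam ε₀ * a t * a (s * t)) (𝓝[<] 0)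
      (𝓝 (L ^ 2 * (bigLam ε₀ / s ^ 2 - s / bigLam ε₀))) := by
  have hs0 : 0 < s := by linarith
  have h1 : Tendsto (fun t => a (t / s)) (𝓝[<] 0) (𝓝 L) := hL.comp (tendsto_div_nhdsLT hs0)
  have h2 : Tendsto (fun t => a (s * t)) (𝓝[<] 0) (𝓝 L) := hL.comp (tendsto_mul_nhdsLT hs0)
  have h3 := ((h1.pow 2).const_mul (bigLam ε₀ / s ^ 2)).sub ((hL.mul h2).const_mul (s / bigLam ε₀))
  refine (h3.congr fun t => by ring).trans ?_
  rw [show bigLam ε₀ / s ^ 2 * L ^ 2 - s / bigLam ε₀ * (L * L) = L ^ 2 * (bigLam ε₀ / s ^ 2 - s / bigLam ε₀)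
    by ring]

/-- **Frozen-wake criterion.**  For a non-zero wake `L ≠ 0` the limiting velocity `L²(Λ/s² − s/Λ)` vanishes
iff `s³ = Λ²` (with `Λ = bigLam ε₀ > 0`, `s > 0`). [cite: Tao2016AveragedNS, §1.2; elementary] -/
theorem frozen_wake_iff (hε : 0 < ε₀) (hs : 1 < s) {L : ℝ} (hL : L ≠ 0) :
    L ^ 2 * (bigLam ε₀ / s ^ 2 - s / bigLam ε₀) = 0 ↔ s ^ 3 = bigLam ε₀ ^ 2 := by
  have hΛ : 0 < bigLam ε₀ := bigLam_pos (by linarith)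
  have hs0 : 0 < s := by linarith
  rw [mul_eq_zero, or_iff_right (pow_ne_zero 2 hL), sub_eq_zero, div_eq_div_iff (by positivity) hΛ.ne']
  constructor <;> intro h <;> nlinarith [h]

/-- **A frozen wake means the Kolmogorov rate exactly**: if `s³ = Λ²` then the per-shell energy ratio of the
front, `dssMu ε₀ (log s) = s²/Λ² = s²/(1+ε₀)⁵`, equals `(1+ε₀)^{−5/3}` — i.e. `μ = Λ^{−2/3}`, the K41 rate
`a = 5/3` of the route's rate ratchet. [cite: Tao2016AveragedNS, §1.2, §4 (4.1); elementary] -/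
theorem dssMu_eq_of_frozen (hε : 0 < ε₀) (hs : 1 < s) (h : s ^ 3 = bigLam ε₀ ^ 2) :
    dssMu ε₀ (Real.log s) = (1 + ε₀) ^ (-(5 : ℝ) / 3) := by
  have hs0 : 0 < s := by linarith
  have hb : 0 < 1 + ε₀ := by linarith
  unfold dssMu
  rw [show 2 * Real.log s = Real.log (s ^ 2) by rw [Real.log_pow]; norm_num, Real.exp_log (by positivity)]
  -- `s ^ 3 = (1+ε₀)^5`, so `s = (1+ε₀)^{5/3}` and `s² / (1+ε₀)^5 = (1+ε₀)^{10/3 - 5}`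
  rw [bigLam_sq hε.le] at h
  have hs' : s = (1 + ε₀) ^ ((5 : ℝ) / 3) := by
    have h1 : s = (s ^ 3) ^ ((1 : ℝ) / 3) := by
      rw [← Real.rpow_natCast, ← Real.rpow_mul hs0.le]; norm_num
    rw [h1, h, ← Real.rpow_natCast, ← Real.rpow_mul hb.le]; norm_num
  rw [hs', ← Real.rpow_two, ← Real.rpow_mul hb.le, ← Real.rpow_natCast (1 + ε₀) 5, ← Real.rpow_sub hb]
  norm_num

end WakeRatchetScalarFront

end Summit.NavierStokesRegularity.NavierStokesRegularity.Theorems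

end
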